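import Literature.RingTheory.PBasis.KimuraNiitsuma1980
import Mathlib.Algebra.MvPolynomial.PDeriv
import Mathlib.Algebra.MvPolynomial.Derivation
import Mathlib.Algebra.CharP.Subring
import Mathlib.RingTheory.Derivation.Basic
import HarnessLib

/-!
# Derivations of a ring with a `p`-basis: the presentation `R = R′[X_Γ]/(X_γ^p − γ^p)` and the
# unique extension of any map `Γ → R` to an `R′`-derivation (Matsumura §26; Kimura–Niitsuma 1980)

Topic: `Literature/RingTheory/PBasis`. Sibling of `KimuraNiitsuma1980.lean` (the notion `IsPBasisOver p R′ Γ`: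
`R′[Γ] = R` and, for every finite `{b₁, …, b_s} ⊆ Γ`, the reduced monomials `∏ bᵢ^{nᵢ}`, `0 ≤ nᵢ < p`,
are `R′`-linearly independent — T. Kimura, H. Niitsuma, J. Math. Soc. Japan **32** (1980), p. 363
l. 7–10, standing setting "`R` of characteristic `p`, `R′` an intermediate ring between `R` and `R^p`").

For such a `p`-basis (`R` any commutative ring of characteristic `p`, `R′ ⊆ R` a subring containing all
`p`-th powers, `Γ ⊆ R` possibly infinite) this file proves, with no hypothesis on fields or finiteness:

* `IsPBasisOver.aeval_val_surjective` — the evaluation `R′[X_γ : γ ∈ Γ] → R`, `X_γ ↦ γ`, is onto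
  (private plumbing: the relations `X_γ^p − γ^p` lie in its kernel and are killed by every derivation);
* `IsPBasisOver.monomial_sub_reduced_mem_relations`, `IsPBasisOver.exists_reduced_sub_mem_relations` —
  every polynomial is congruent, modulo the RELATIONS IDEAL `(X_γ^p − γ^p : γ ∈ Γ)`, to a REDUCED one
  (all exponents `< p`): `X^d ≡ (∏ (γ^p)^{⌊d_γ/p⌋}) · X^{d mod p}`;
* `IsPBasisOver.eq_zero_of_aeval_eq_zero` — a reduced polynomial vanishing at `Γ` is zero (this is the
  finite-family independence clause of the definition, read on the finitely many variables that occur);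
* `IsPBasisOver.ker_aeval_eq_relations` — **PRESENTATION**: the kernel of `R′[X_Γ] → R` is exactly
  `(X_γ^p − γ^p : γ ∈ Γ)`, i.e. `R ≅ R′[X_Γ]/(X_γ^p − γ^p)`;
* `IsPBasisOver.exists_derivation_apply_eq`, `IsPBasisOver.derivation_ext`,
  `IsPBasisOver.existsUnique_derivation_apply_eq` — **every map `v : Γ → R` extends UNIQUELY to an
  `R′`-derivation `D : R → R` with `D γ = v γ`** (Matsumura, *Commutative Ring Theory*, §26, p. 202,
  the paragraph before Theorem 26.5, printed for fields: "any map `D : B → K` has a unique extension to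
  an element `D ∈ Der_k(K)`"; here for rings, by a different but standard road: the derivation
  `X_γ ↦ (a lift of) v γ` of the polynomial ring kills the relations, `D(X_γ^p − γ^p) = p X_γ^{p−1} D X_γ = 0`
  in characteristic `p`, so it descends through the presentation — Mathlib `Derivation.liftOfSurjective`);
* `IsPBasisOver.exists_dual_derivation` (+ `_int`, + the `R′ = R^p` forms `…_frobenius`) — in
  particular the DUAL DERIVATIONS `∂_γ₀` (`∂_γ₀ γ₀ = 1`, `∂_γ₀ γ = 0` for `γ ≠ γ₀`), as `R′`-derivations
  and as plain (`ℤ`-)derivations of `R` (the form in which Giraud 1983, 2.6, differentiates the expansion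
  `f = Σ f_b^p Γ^b` termwise; cf. Matsumura Thm 30.5 (2) "define `D_γ ∈ Der(S)` by `D_γ(u_{γ′}) = δ_{γγ′}`").

Everything is a theorem (no named facts, no new definitions); NOT statements of H. Hironaka's manuscript.
Written by the HIRONAKA-L fact liaison res-D-lit-1 for the W8.1 `p`-basis layer (K2-DESIGN §5.7 (P2)).

## References
* H. Matsumura, *Commutative Ring Theory*, CUP 1986/1989: §26 p. 202 (derivations from a `p`-basis,
  before Thm 26.5); Thm 30.5 (2) p. 234 (dual derivations `D_γ`). [Matsumura1987]
* T. Kimura, H. Niitsuma, J. Math. Soc. Japan 32 (1980) 363–371: definition of a `p`-basis of `R`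
  over `R′`, p. 363 l. 7–10. [KimuraNiitsuma1980]
-/

noncomputable section

namespace Literature.RingTheory.PBasis

universe u

open MvPolynomial

namespace IsPBasisOver

variable {p : ℕ} {R : Type u} [CommRing R] {R' : Subring R} {Γ : Set R}

/-! ### 1. The evaluation `R′[X_Γ] → R` is surjective -/

/-- For a `p`-basis `Γ` of `R` over `R′` the evaluation `R′[X_γ : γ ∈ Γ] → R`, `X_γ ↦ γ`, is
surjective (`R′[Γ] = R`). [cite: KimuraNiitsuma1980, p. 363 l. 7–10] -/
theorem aeval_val_surjective (h : IsPBasisOver p R' Γ) :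
    Function.Surjective (aeval ((↑) : Γ → R) : MvPolynomial Γ R' →ₐ[R'] R) := by
  rw [← AlgHom.range_eq_top, ← Algebra.adjoin_range_eq_range_aeval, Subtype.range_coe]
  exact h.1

/-- The relations `X_γ^p − γ^p` evaluate to `0`. [folklore] -/
private theorem aeval_X_pow_sub_C (hR' : ∀ x : R, x ^ p ∈ R') (γ : Γ) :
    aeval ((↑) : Γ → R) (X γ ^ p - C ⟨((γ : Γ) : R) ^ p, hR' _⟩ : MvPolynomial Γ R') = 0 := by
  rw [map_sub, map_pow, aeval_X, aeval_C]
  exact sub_self _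

/-- The relations ideal `(X_γ^p − γ^p : γ ∈ Γ)` is contained in the kernel of the evaluation.
[folklore] -/
private theorem relations_le_ker_aeval (hR' : ∀ x : R, x ^ p ∈ R') :
    Ideal.span (Set.range fun γ : Γ =>
        (X γ ^ p - C ⟨((γ : Γ) : R) ^ p, hR' _⟩ : MvPolynomial Γ R')) ≤
      RingHom.ker (aeval ((↑) : Γ → R) : MvPolynomial Γ R' →ₐ[R'] R) := by
  rw [Ideal.span_le]
  rintro _ ⟨γ, rfl⟩
  exact aeval_X_pow_sub_C hR' γ

/-! ### 2. Reduction of exponents modulo the relations -/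

/-- **Exponent reduction.** Modulo `(X_γ^p − γ^p : γ ∈ Γ)` the monomial `a X^d` is congruent to the
REDUCED monomial `(a ∏_γ (γ^p)^{⌊d_γ/p⌋}) X^{d mod p}` (write `X_γ^{d_γ} = (X_γ^p)^{⌊d_γ/p⌋} X_γ^{d_γ mod p}`
and replace `X_γ^p` by `γ^p ∈ R′`) — the computation behind "`Γ_B` [the reduced monomials] being a
basis … in the sense of linear algebra" (Matsumura p. 202) / "`R′[Γ] = R`" read on monomials
(Kimura–Niitsuma p. 363). [cite: Matsumura1987, §26 p. 202 (before Thm 26.5); KimuraNiitsuma1980,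
p. 363 l. 7–10] -/
theorem monomial_sub_reduced_mem_relations (hR' : ∀ x : R, x ^ p ∈ R') (d : Γ →₀ ℕ) (a : R') :
    (monomial d a : MvPolynomial Γ R') -
        monomial (d.mapRange (· % p) (Nat.zero_mod p))
          (a * d.prod fun γ n => (⟨((γ : Γ) : R) ^ p, hR' _⟩ : R') ^ (n / p)) ∈
      Ideal.span (Set.range fun γ : Γ =>
        (X γ ^ p - C ⟨((γ : Γ) : R) ^ p, hR' _⟩ : MvPolynomial Γ R')) := by
  classical
  set J : Ideal (MvPolynomial Γ R') := Ideal.span (Set.range fun γ : Γ =>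
    (X γ ^ p - C ⟨((γ : Γ) : R) ^ p, hR' _⟩ : MvPolynomial Γ R')) with hJ
  rw [← Ideal.Quotient.eq]
  set mk := Ideal.Quotient.mk J with hmk
  -- the basic congruence `X_γ^p ≡ γ^p`
  have hX : ∀ γ : Γ, mk (X γ) ^ p = mk (C ⟨((γ : Γ) : R) ^ p, hR' _⟩) := by
    intro γ
    rw [← map_pow, hmk, Ideal.Quotient.eq]
    exact Ideal.subset_span ⟨γ, rfl⟩
  -- hence `X_γ^n ≡ (γ^p)^{⌊n/p⌋} X_γ^{n mod p}`
  have hXn : ∀ (γ : Γ) (n : ℕ), mk (X γ) ^ n =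
      mk (C ⟨((γ : Γ) : R) ^ p, hR' _⟩) ^ (n / p) * mk (X γ) ^ (n % p) := by
    intro γ n
    conv_lhs => rw [← Nat.div_add_mod n p]
    rw [pow_add, pow_mul, hX]
  simp only [monomial_eq, map_mul, map_finsuppProd, map_pow]
  rw [Finsupp.prod_mapRange_index (fun _ => pow_zero _)]
  have hprod : (d.prod fun (γ : Γ) (n : ℕ) => mk (X γ) ^ n) =
      d.prod fun γ n => mk (C ⟨((γ : Γ) : R) ^ p, hR' _⟩) ^ (n / p) * mk (X γ) ^ (n % p) :=
    Finsupp.prod_congr fun γ _ => hXn γ _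
  rw [hprod, Finsupp.prod_mul]
  ring

/-- **Every polynomial is congruent to a reduced one** modulo `(X_γ^p − γ^p : γ ∈ Γ)`: there is `g`
all of whose exponents are `< p` with `f − g` in the relations ideal (spanning half of "the reduced
monomials are a basis", Matsumura p. 202). [cite: Matsumura1987, §26 p. 202 (before Thm 26.5)] -/
theorem exists_reduced_sub_mem_relations [Fact p.Prime] (hR' : ∀ x : R, x ^ p ∈ R')
    (f : MvPolynomial Γ R') :
    ∃ g : MvPolynomial Γ R', (∀ d ∈ g.support, ∀ γ, d γ < p) ∧
      f - g ∈ Ideal.span (Set.range fun γ : Γ =>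
        (X γ ^ p - C ⟨((γ : Γ) : R) ^ p, hR' _⟩ : MvPolynomial Γ R')) := by
  classical
  have hp : p.Prime := Fact.out
  refine ⟨∑ d ∈ f.support, monomial (d.mapRange (· % p) (Nat.zero_mod p))
      (coeff d f * d.prod fun γ n => (⟨((γ : Γ) : R) ^ p, hR' _⟩ : R') ^ (n / p)), ?_, ?_⟩
  · intro d hd γ
    obtain ⟨d₀, -, hd₀⟩ := Finset.mem_biUnion.mp (support_sum hd)
    have hdd : d = d₀.mapRange (· % p) (Nat.zero_mod p) :=
      Finset.mem_singleton.mp (support_monomial_subset hd₀)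
    rw [hdd, Finsupp.mapRange_apply]
    exact Nat.mod_lt _ hp.pos
  · have hf : f - ∑ d ∈ f.support, monomial (d.mapRange (· % p) (Nat.zero_mod p))
        (coeff d f * d.prod fun γ n => (⟨((γ : Γ) : R) ^ p, hR' _⟩ : R') ^ (n / p)) =
        ∑ d ∈ f.support, ((monomial d (coeff d f) : MvPolynomial Γ R') -
          monomial (d.mapRange (· % p) (Nat.zero_mod p))
            (coeff d f * d.prod fun γ n => (⟨((γ : Γ) : R) ^ p, hR' _⟩ : R') ^ (n / p))) := by
      rw [Finset.sum_sub_distrib, ← f.as_sum]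
    rw [hf]
    exact Ideal.sum_mem _ fun d _ => monomial_sub_reduced_mem_relations hR' d _

/-! ### 3. Reduced polynomials vanishing at `Γ` are zero -/

/-- **A reduced polynomial vanishing at the `p`-basis is zero.** If all exponents of
`g ∈ R′[X_Γ]` are `< p` and `g(Γ) = 0` in `R`, then `g = 0`: on the finitely many variables occurring
in `g` this is the linear independence of the reduced monomials required by the definition of a
`p`-basis. [cite: KimuraNiitsuma1980, p. 363 l. 7–10] -/
theorem eq_zero_of_aeval_eq_zero (h : IsPBasisOver p R' Γ) {g : MvPolynomial Γ R'}
    (hg : ∀ d ∈ g.support, ∀ γ, d γ < p) (h0 : aeval ((↑) : Γ → R) g = 0) : g = 0 := by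
  classical
  -- the finitely many elements of `Γ` that occur in `g`
  set G : Finset Γ := g.support.biUnion fun d => d.support with hG
  have hsub : ∀ d ∈ g.support, d.support ⊆ G := fun d hd =>
    Finset.subset_biUnion_of_mem (fun d : Γ →₀ ℕ => d.support) hd
  set k := G.card
  let e : ↥G ≃ Fin k := G.equivFin
  let bv : Fin k → R := fun i => (((e.symm i : ↥G) : Γ) : R)
  have hbinj : Function.Injective bv := by
    intro i j hij
    have : (e.symm i : ↥G) = e.symm j := Subtype.ext (Subtype.ext hij)
    exact e.symm.injective this
  have hbΓ : ∀ i, bv i ∈ Γ := fun i => (((e.symm i : ↥G) : Γ)).2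
  have hli := h.2 k bv hbinj hbΓ
  -- the exponent vectors of `g`, read on `Fin k`
  let φ : ↥g.support → (Fin k → Fin p) := fun d i =>
    ⟨d.1 ((e.symm i : ↥G) : Γ), hg d.1 d.2 _⟩
  have hφ : Function.Injective φ := by
    intro d d' hdd'
    apply Subtype.ext
    ext γ
    by_cases hγ : γ ∈ G
    · have := congrArg (fun f : Fin k → Fin p => (f (e ⟨γ, hγ⟩) : ℕ)) hdd'
      simpa [φ] using this
    · have h1 : γ ∉ d.1.support := fun hm => hγ (hsub d.1 d.2 hm)
      have h2 : γ ∉ d'.1.support := fun hm => hγ (hsub d'.1 d'.2 hm)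
      rw [Finsupp.notMem_support_iff.mp h1, Finsupp.notMem_support_iff.mp h2]
  have hli' := hli.comp φ hφ
  -- `g(Γ) = Σ_d coeff_d • ∏ bv i ^ (φ d i)`
  have hmon : ∀ d : ↥g.support,
      (d.1.prod fun (γ : Γ) (n : ℕ) => ((γ : Γ) : R) ^ n) = ∏ i, bv i ^ ((φ d i : Fin p) : ℕ) := by
    intro d
    rw [Finsupp.prod_of_support_subset _ (hsub d.1 d.2) _ (fun γ _ => pow_zero _),
      ← Finset.prod_coe_sort G, ← Equiv.prod_comp e.symm]
  have hsum : ∑ d : ↥g.support, (coeff d.1 g) • (∏ i, bv i ^ ((φ d i : Fin p) : ℕ)) = 0 := by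
    have H := h0
    rw [g.as_sum, map_sum, ← Finset.sum_coe_sort] at H
    rw [← H]
    refine Finset.sum_congr rfl fun d _ => ?_
    rw [aeval_monomial, Algebra.smul_def, hmon d]
  have hcoef := Fintype.linearIndependent_iff.mp hli' (fun d => coeff d.1 g) hsum
  refine MvPolynomial.ext _ _ fun d => ?_
  rw [coeff_zero]
  by_contra hne
  exact hne (hcoef ⟨d, mem_support_iff.mpr hne⟩)

/-! ### 4. The presentation `R ≅ R′[X_Γ]/(X_γ^p − γ^p)` -/

/-- **Presentation of a ring with a `p`-basis.** For a `p`-basis `Γ` of `R` over a subring `R′`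
containing all `p`-th powers, the kernel of the (surjective) evaluation `R′[X_γ : γ ∈ Γ] → R` is the
ideal `(X_γ^p − γ^p : γ ∈ Γ)`; that is, `R ≅ R′[X_Γ]/(X_γ^p − γ^p)`. [cite: KimuraNiitsuma1980, p. 363
l. 7–10 (definition); Matsumura1987, §26 p. 202] -/
theorem ker_aeval_eq_relations [Fact p.Prime] (h : IsPBasisOver p R' Γ) (hR' : ∀ x : R, x ^ p ∈ R') :
    RingHom.ker (aeval ((↑) : Γ → R) : MvPolynomial Γ R' →ₐ[R'] R) =
      Ideal.span (Set.range fun γ : Γ =>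
        (X γ ^ p - C ⟨((γ : Γ) : R) ^ p, hR' _⟩ : MvPolynomial Γ R')) := by
  refine le_antisymm (fun f hf => ?_) (relations_le_ker_aeval hR')
  obtain ⟨g, hg, hfg⟩ := exists_reduced_sub_mem_relations hR' f
  have hg0 : aeval ((↑) : Γ → R) g = 0 := by
    have H := relations_le_ker_aeval hR' hfg
    rw [RingHom.mem_ker, map_sub, RingHom.mem_ker.mp hf, zero_sub, neg_eq_zero] at H
    exact H
  have := eq_zero_of_aeval_eq_zero h hg hg0
  rw [this, sub_zero] at hfg
  exact hfg

/-! ### 5. Derivations: unique extension of any map `Γ → R` -/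

/-- A derivation of `R′[X_Γ]` maps the relations ideal `(X_γ^p − γ^p)` into itself — in fact it kills
the generators: `D(X_γ^p − c) = p X_γ^{p−1} D(X_γ) = 0` in characteristic `p`. [folklore] -/
private theorem derivation_apply_mem_relations [Fact p.Prime] [CharP R p] (hR' : ∀ x : R, x ^ p ∈ R')
    (D : Derivation R' (MvPolynomial Γ R') (MvPolynomial Γ R')) {y : MvPolynomial Γ R'}
    (hy : y ∈ Ideal.span (Set.range fun γ : Γ =>
        (X γ ^ p - C ⟨((γ : Γ) : R) ^ p, hR' _⟩ : MvPolynomial Γ R'))) :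
    D y ∈ Ideal.span (Set.range fun γ : Γ =>
        (X γ ^ p - C ⟨((γ : Γ) : R) ^ p, hR' _⟩ : MvPolynomial Γ R')) := by
  set J : Ideal (MvPolynomial Γ R') := Ideal.span (Set.range fun γ : Γ =>
    (X γ ^ p - C ⟨((γ : Γ) : R) ^ p, hR' _⟩ : MvPolynomial Γ R')) with hJ
  refine Submodule.span_induction ?_ ?_ ?_ ?_ hy
  · rintro _ ⟨γ, rfl⟩
    have : D (X γ ^ p - C ⟨((γ : Γ) : R) ^ p, hR' _⟩ : MvPolynomial Γ R') = 0 := by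
      rw [map_sub, derivation_C, sub_zero, D.leibniz_pow, smul_eq_mul, nsmul_eq_mul,
        CharP.cast_eq_zero (MvPolynomial Γ R') p, zero_mul]
    rw [this]
    exact J.zero_mem
  · rw [map_zero]; exact J.zero_mem
  · intro a b _ _ ha hb
    rw [map_add]; exact J.add_mem ha hb
  · intro a b hb hDb
    rw [smul_eq_mul, D.leibniz, smul_eq_mul, smul_eq_mul]
    exact J.add_mem (J.mul_mem_left a hDb) (J.mul_mem_right _ hb)

/-- **Derivations from a `p`-basis (Matsumura §26, ring form) — existence.** For a `p`-basis `Γ` of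
`R` over a subring `R′ ⊇ R^p` and ANY map `v : Γ → R` there is an `R′`-derivation `D : R → R` with
`D γ = v γ` for all `γ ∈ Γ`. Construction: the derivation `X_γ ↦ ṽ_γ` of `R′[X_Γ]` (`ṽ_γ` any lift of
`v γ`) kills the kernel `(X_γ^p − γ^p)` of the presentation (`ker_aeval_eq_relations`,
`derivation_apply_mem_relations`), hence descends to `R` (Mathlib `Derivation.liftOfSurjective`).
[cite: Matsumura1987, §26 p. 202 (before Thm 26.5)] -/
theorem exists_derivation_apply_eq [Fact p.Prime] [CharP R p] (h : IsPBasisOver p R' Γ)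
    (hR' : ∀ x : R, x ^ p ∈ R') (v : Γ → R) :
    ∃ D : Derivation R' R R, ∀ γ : Γ, D γ = v γ := by
  have hπ := aeval_val_surjective h
  set s := Function.surjInv hπ with hs
  set d : Derivation R' (MvPolynomial Γ R') (MvPolynomial Γ R') :=
    mkDerivation R' (fun γ : Γ => s (v γ)) with hd_def
  have hd : ∀ x, (aeval ((↑) : Γ → R) : MvPolynomial Γ R' →ₐ[R'] R) x = 0 →
      (aeval ((↑) : Γ → R) : MvPolynomial Γ R' →ₐ[R'] R) (d x) = 0 := by
    intro x hx
    have hxJ : x ∈ Ideal.span (Set.range fun γ : Γ =>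
        (X γ ^ p - C ⟨((γ : Γ) : R) ^ p, hR' _⟩ : MvPolynomial Γ R')) := by
      rw [← ker_aeval_eq_relations h hR']
      exact hx
    exact relations_le_ker_aeval hR' (derivation_apply_mem_relations hR' d hxJ)
  refine ⟨Derivation.liftOfSurjective hπ hd, fun γ => ?_⟩
  have hγ : ((γ : Γ) : R) = (aeval ((↑) : Γ → R) : MvPolynomial Γ R' →ₐ[R'] R) (X γ) :=
    (aeval_X _ _).symm
  rw [hγ, Derivation.liftOfSurjective_apply, hd_def, mkDerivation_X, hs]
  exact Function.surjInv_eq hπ _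

/-- **Uniqueness**: two `R′`-derivations of `R` (into any module) that agree on a generating set `Γ`
(`R′[Γ] = R`) are equal. [cite: Matsumura1987, §26 p. 202 (before Thm 26.5)] -/
theorem derivation_ext {M : Type*} [AddCommGroup M] [Module R M] [Module R' M] [IsScalarTower R' R M]
    (h : IsPBasisOver p R' Γ) {D₁ D₂ : Derivation R' R M} (hD : ∀ γ : Γ, D₁ γ = D₂ γ) : D₁ = D₂ :=
  Derivation.ext_of_adjoin_eq_top Γ h.1 fun x hx => hD ⟨x, hx⟩

/-- **Derivations from a `p`-basis (Matsumura §26, ring form).** For a `p`-basis `Γ` of `R` over a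
subring `R′ ⊇ R^p`, every map `v : Γ → R` has a UNIQUE extension to an `R′`-derivation `D : R → R`
(printed for fields, *Commutative Ring Theory* p. 202: "any map `D : B → K` has a unique extension to an
element `D ∈ Der_k(K)`"; equivalently `Der_{R′}(R, R) ≅ R^Γ`, `Ω_{R/R′}` free on `dΓ`).
[cite: Matsumura1987, §26 p. 202 (before Thm 26.5)] -/
theorem existsUnique_derivation_apply_eq [Fact p.Prime] [CharP R p] (h : IsPBasisOver p R' Γ)
    (hR' : ∀ x : R, x ^ p ∈ R') (v : Γ → R) :
    ∃! D : Derivation R' R R, ∀ γ : Γ, D γ = v γ := by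
  obtain ⟨D, hD⟩ := exists_derivation_apply_eq h hR' v
  exact ⟨D, hD, fun D' hD' => derivation_ext h fun γ => (hD' γ).trans (hD γ).symm⟩

/-! ### 6. Dual derivations -/

/-- **Dual derivations of a `p`-basis.** For a `p`-basis `Γ` of `R` over `R′ ⊇ R^p` and `γ₀ ∈ Γ` there
is an `R′`-derivation `∂ : R → R` with `∂ γ₀ = 1` and `∂ γ = 0` for every other `γ ∈ Γ` (Matsumura,
Thm 30.5 (2): "define `D_γ ∈ Der(S)` by `D_γ(u_{γ′}) = δ_{γγ′}`"). [cite: Matsumura1987, §26 p. 202;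
Thm 30.5 (2) p. 234] -/
theorem exists_dual_derivation [Fact p.Prime] [CharP R p] (h : IsPBasisOver p R' Γ)
    (hR' : ∀ x : R, x ^ p ∈ R') (γ₀ : Γ) :
    ∃ D : Derivation R' R R, D γ₀ = 1 ∧ ∀ γ : Γ, γ ≠ γ₀ → D γ = 0 := by
  classical
  obtain ⟨D, hD⟩ := exists_derivation_apply_eq h hR' (fun γ => if γ = γ₀ then 1 else 0)
  exact ⟨D, by simpa using hD γ₀, fun γ hγ => by simpa [hγ] using hD γ⟩

/-- The same dual derivation as a plain (`ℤ`-linear) derivation of `R` — the reading used when one only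
differentiates: `∂ γ₀ = 1`, `∂ γ = 0` (`γ ≠ γ₀`), and `∂` vanishes on `R′`. [cite: Matsumura1987,
Thm 30.5 (2) p. 234] -/
theorem exists_dual_derivation_int [Fact p.Prime] [CharP R p] (h : IsPBasisOver p R' Γ)
    (hR' : ∀ x : R, x ^ p ∈ R') (γ₀ : Γ) :
    ∃ D : Derivation ℤ R R, D γ₀ = 1 ∧ (∀ γ : Γ, γ ≠ γ₀ → D γ = 0) ∧ ∀ c : R', D c = 0 := by
  obtain ⟨D, h₀, h₁⟩ := exists_dual_derivation h hR' γ₀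
  exact ⟨D.restrictScalars ℤ, h₀, h₁, fun c => D.map_algebraMap c⟩

/-! ### 7. The case `R′ = R^p` (the range of Frobenius) -/

section Frobenius

variable [Fact p.Prime] [CharP R p]

/-- For `R′ = R^p = range (frobenius R p)` the standing hypothesis "`R′` contains all `p`-th powers"
holds tautologically. [folklore] -/
private theorem pow_mem_frobenius_range (x : R) : x ^ p ∈ (frobenius R p).range :=
  ⟨x, frobenius_def ..⟩

/-- **Derivations from a `p`-basis over `R^p`**: every `v : Γ → R` extends uniquely to an
`R^p`-derivation of `R`. [cite: Matsumura1987, §26 p. 202 (before Thm 26.5)] -/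
theorem existsUnique_derivation_apply_eq_frobenius {Γ : Set R}
    (h : IsPBasisOver p (frobenius R p).range Γ) (v : Γ → R) :
    ∃! D : Derivation (frobenius R p).range R R, ∀ γ : Γ, D γ = v γ :=
  existsUnique_derivation_apply_eq h pow_mem_frobenius_range v

/-- **Dual derivations of a `p`-basis over `R^p`**, as plain derivations of `R`: for `γ₀ ∈ Γ` there is
`∂ : Derivation ℤ R R` with `∂ γ₀ = 1` and `∂ γ = 0` for the other `γ ∈ Γ` (every derivation kills
`R^p` in characteristic `p`). This is the input "`D` dual to `γ₀`" of the termwise differentiation of the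
expansion `f = Σ_b f_b^p Γ^b` (Giraud 1983, 2.6). [cite: Matsumura1987, Thm 30.5 (2) p. 234] -/
theorem exists_dual_derivation_frobenius {Γ : Set R} (h : IsPBasisOver p (frobenius R p).range Γ)
    (γ₀ : Γ) : ∃ D : Derivation ℤ R R, D γ₀ = 1 ∧ ∀ γ : Γ, γ ≠ γ₀ → D γ = 0 := by
  obtain ⟨D, h₀, h₁, -⟩ := exists_dual_derivation_int h pow_mem_frobenius_range γ₀
  exact ⟨D, h₀, h₁⟩

/-- **All values at once**: for a `p`-basis `Γ` over `R^p` and any `v : Γ → R` there is a derivation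
`D : Derivation ℤ R R` with `D γ = v γ` on `Γ`. [cite: Matsumura1987, §26 p. 202 (before Thm 26.5)] -/
theorem exists_derivation_apply_eq_frobenius {Γ : Set R} (h : IsPBasisOver p (frobenius R p).range Γ)
    (v : Γ → R) : ∃ D : Derivation ℤ R R, ∀ γ : Γ, D γ = v γ := by
  obtain ⟨D, hD⟩ := exists_derivation_apply_eq h pow_mem_frobenius_range v
  exact ⟨D.restrictScalars ℤ, hD⟩

end Frobenius

end IsPBasisOver

end Literature.RingTheory.PBasis

end
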